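import Literature.NumberTheory.Automorphic.UnboundedDenominatorsCuspExpansionProofs
import Literature.NumberTheory.Automorphic.UnboundedDenominatorsSpanBoundProofs
import Literature.NumberTheory.Automorphic.ModularLambdaSurjective
import Literature.Analysis.Complex.RootsOfUnityComplementRadiusLowerBound
import Literature.Analysis.Complex.RootsOfUnityComplementUniformization
import HarnessLib

/-!
# The unbounded denominators theorem (Calegari–Dimitrov–Tang) — Proposition 3.0.1, formal side II:
# `[R_N : M_2] ≤ C N³ log N`, and Theorem 1.0.1 from four printed inputs

PROOF-ONLY sequel (no definition, no named fact; D-0026) of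
`UnboundedDenominatorsCuspExpansionProofs.lean` (integral `t`-expansions of the twisted generators
`h = (λ/16)^{2m} F/Δᵐ`), of `UnboundedDenominatorsGeneratorAnalytic.lean` (the twisted generators
satisfy hypothesis `han` of the holonomy bound along the universal covering of `ℂ ∖ μ_n`), of
`Literature/Analysis/Complex/RootsOfUnityComplementRadiusLowerBound.lean`
(`CalegariDimitrovTang2025_unboundedDenominators.dim_le_unconditional`: CDT Theorem 2.0.1 with the
radius bound Theorem 5.1.4, unconditional) and of `UnboundedDenominatorsSpanBoundProofs.lean`
(`…of_printed_inputs''`: Theorem 1.0.1 from `hker₂`, `hcor`, Shimura 3.52, (4.3.3) and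
Proposition 3.0.1 as a bound on `M_2`-independent families of generators of `R_N`).
Source: F. Calegari, V. Dimitrov, Y. Tang, *The unbounded denominators conjecture*, J. Amer. Math.
Soc. **38** (2025), 627–702 = arXiv:2109.09040, Proposition 3.0.1 and its proof ("We use
Theorem 2.0.1 with `U := ℂ ∖ 16^{-1/N}μ_N`, `p(x) := xᴺ` and `x := (λ/16)^{1/N} ∈ t + t²ℤ[1/N]⟦t⟧` …
the `ℚ(λ)`-linear dimension of the holonomic `ℚ(λ)`-module generated by all these functions is at
most `C N³ log N`") and §6.3.

What is proved here (sorry-free):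

* `exists_subst_formalRoot_eq` — the formal change of variable: for the formal root
  `x ∈ t + t²ℚ⟦t⟧` and any `H ∈ ℚ⟦t⟧` there is `f ∈ ℚ⟦X⟧` with `f(x(t)) = H(t)` (Mathlib's
  compositional inverse `PowerSeries.substInv`);
* `exists_formalExpansion_twistedGen` — for a generator `F/Δᵐ` of `R_{2n}` the formal expansion
  `f = x^*h` of `h = (λ/16)^{2m} F/Δᵐ` with the three data of the holonomy bound: integrality
  `f(x(t)) ∈ ℤ⟦t⟧` (`hint`), `f(x) = 𝓣h` (`hfH`) and admissibility along the universal covering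
  (`han`, from `exists_taylor_subst_eq_modFun`);
* ★ `eq_zero_of_sum_aeval_mul_formalExpansion_eq_zero` — **TRANSFER of linear independence**: if the
  generators `Fᵢ/Δ^{mᵢ}` are linearly independent over `M_2 = ℂ(λ)` then their formal expansions
  `fᵢ` admit no nontrivial relation `Σ Qᵢ(Xⁿ) fᵢ = 0` with `Qᵢ ∈ ℚ[X]` (`Xⁿ ↔ λ/16`; injectivity of
  `q`-expansions and `λ ∈ M_2`);
* ★★ `linearIndepOn_bddDenGens_card_le` — **CDT Proposition 3.0.1 in the shape consumed by §6.3**: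
  there is `C` such that for every even `N > 0`, every finite set of generators of `R_N` linearly
  independent over `M_2` has at most `C N³ log N` elements;
* ★★★ `CalegariDimitrovTang2025_unboundedDenominators.of_printed_inputs'''` — **Theorem 1.0.1 from
  FOUR printed inputs**: `hker₂` (amalgam + congruence subgroup property for `SL₂(ℤ[1/p])`),
  `hcor` (CDT Corollary 4.5.3), Shimura's Theorem 3.52 (integral spanning of `M_{12m}(Γ(N))`) and
  the degree formula (4.3.3) `c N³ ≤ [M_N : M_2]`. Proposition 3.0.1 is no longer an input.

Nothing here proves the four remaining inputs; K★ / Manin / BSD are not touched.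

## References

* [CalegariDimitrovTang2025] F. Calegari, V. Dimitrov, Y. Tang, The unbounded denominators
  conjecture, J. Amer. Math. Soc. 38 (2025), no. 3, 627–702; arXiv:2109.09040. Proposition 3.0.1
  (and its proof), Theorem 2.0.1, Theorem 5.1.4, §6.3.
-/

noncomputable section

namespace Literature.NumberTheory.Automorphic

open scoped MatrixGroups ModularForm Manifold
open UpperHalfPlane hiding I
open CongruenceSubgroup Matrix.SpecialLinearGroup ModularGroup Function Set Metric
open Literature.NumberTheory.ModularForms.QExpansionAlgebra
open Literature.NumberTheory.Automorphic.ModularLambda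
open Literature.Analysis.Complex

namespace UnboundedDenominators

/-! ### §1. The formal change of variable `t = t(x)` -/

/-- **Formal change of variable.** For `x ∈ t + t²ℚ⟦t⟧` (constant term `0`, linear term `1`) and
any `H ∈ ℚ⟦t⟧` there is `f ∈ ℚ⟦X⟧` with `f(x(t)) = H(t)`, namely `f = H ∘ x⁻¹` for the
compositional inverse `x⁻¹` (Mathlib `PowerSeries.substInv`). This is CDT's "formal `x`-expansion
`x^* f` of `f(q) = f(q(x))`". [cite: CalegariDimitrovTang2025, §3, proof of Proposition 3.0.1] -/
theorem exists_subst_formalRoot_eq {x : PowerSeries ℚ} (hx0 : PowerSeries.constantCoeff x = 0)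
    (hx1 : PowerSeries.coeff 1 x = 1) (H : PowerSeries ℚ) :
    ∃ f : PowerSeries ℚ, f.subst x = H := by
  have hu : IsUnit (PowerSeries.coeff 1 x) := by rw [hx1]; exact isUnit_one
  refine ⟨H.subst (x.substInvOfIsUnit hu), ?_⟩
  rw [PowerSeries.subst_comp_subst_apply
    (PowerSeries.HasSubst.of_constantCoeff_zero' (PowerSeries.constantCoeff_substInvOfIsUnit x hu))
    (PowerSeries.HasSubst.of_constantCoeff_zero' hx0), PowerSeries.subst_substInvOfIsUnit_left x hx0,
    PowerSeries.X_subst]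

/-- `(ℚ → ℂ) ∘ (ℤ → ℚ) = (ℤ → ℂ)` on power series. [folklore] -/
private theorem map_map_int (H : PowerSeries ℤ) :
    PowerSeries.map (algebraMap ℚ ℂ) (PowerSeries.map (Int.castRingHom ℚ) H) =
      PowerSeries.map (Int.castRingHom ℂ) H := by
  rw [← RingHom.comp_apply, ← PowerSeries.map_comp,
    RingHom.ext_int ((algebraMap ℚ ℂ).comp (Int.castRingHom ℚ)) (Int.castRingHom ℂ)]

/-- `PowerSeries.map` commutes with substitution (Mathlib `PowerSeries.map_subst`, restated with
`PowerSeries.map` on both sides). [folklore] -/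
private theorem map_subst' {f x : PowerSeries ℚ} (hx : PowerSeries.HasSubst x) (φ : ℚ →+* ℂ) :
    PowerSeries.map φ (f.subst x) = (PowerSeries.map φ f).subst (PowerSeries.map φ x) :=
  PowerSeries.map_subst hx f

/-- **The formal expansion of a generator.** Let `Φ` be the universal covering of `ℂ ∖ μ_n` based at
`0`, `x` the formal root (`x ≡ t`, `xⁿ = L(tⁿ)`, `qExpansion 2 (λ/16) = L`), `G` of finite index
containing every conjugate of `T^{2n}` and `F ∈ M_{12m}(G)` with `F ∈ ℤ⟦q_{2n}⟧`. Then the twisted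
generator `h = (λ/16)^{2m} F/Δᵐ` has a formal expansion `f ∈ ℚ⟦X⟧` with `f(x(t)) ∈ ℤ⟦t⟧`
(`hint`), `f(x) = 𝓣h = qExpansion (2n) h` (`hfH`) and, for every `0 < r < 1`, `f(𝓣[16^{-1/n}Φ(r·)])`
is the Taylor series of a function analytic about the closed unit disc (`han`).
[cite: CalegariDimitrovTang2025, §3, proof of Proposition 3.0.1, and §6.3 (6.3.1)] -/
theorem exists_formalExpansion_twistedGen {n : ℕ} (hn : 0 < n) {Φ : ℂ → ℂ}
    (hΦ : DifferentiableOn ℂ Φ (ball (0 : ℂ) 1))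
    (hΦU : MapsTo Φ (ball (0 : ℂ) 1) {z : ℂ | z ^ n ≠ 1})
    (hcov : IsCoveringMap hΦU.restrict) (hΦ0 : Φ 0 = 0)
    {L : PowerSeries ℤ}
    (hL : qExpansion 2 (fun τ : ℍ ↦ modularLambda τ / 16) = L.map (Int.castRingHom ℂ))
    {x : PowerSeries ℚ} (hx0 : PowerSeries.constantCoeff x = 0) (hx1 : PowerSeries.coeff 1 x = 1)
    (hxN : x ^ n = PowerSeries.expand n hn.ne' (L.map (Int.castRingHom ℚ)))
    {G : Subgroup SL(2, ℤ)} [G.FiniteIndex] {m : ℕ}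
    (hconj : ∀ g : SL(2, ℤ), g * T ^ (2 * n) * g⁻¹ ∈ G)
    (F : ModularForm (G : Subgroup (GL (Fin 2) ℝ)) (12 * (m : ℤ)))
    (hint : ∀ k : ℕ, ∃ z : ℤ, PowerSeries.coeff k (qExpansion ((2 * n : ℕ) : ℝ) F) = (z : ℂ)) :
    ∃ f : PowerSeries ℚ,
      (∃ H : PowerSeries ℤ, PowerSeries.map (Int.castRingHom ℚ) H = f.subst x) ∧
      (PowerSeries.map (algebraMap ℚ ℂ) (f.subst x) = qExpansion ((2 * n : ℕ) : ℝ)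
        (fun τ : ℍ ↦ (modularLambda τ / 16) ^ (2 * m) * (F τ / ModularForm.discriminant τ ^ m))) ∧
      ∀ r : ℝ, 0 < r → r < 1 → ∃ g : ℂ → ℂ, AnalyticOnNhd ℂ g (closedBall 0 1) ∧
        (PowerSeries.map (algebraMap ℚ ℂ) f).subst (PowerSeries.mk fun k ↦
            iteratedDeriv k (fun z : ℂ ↦ (((16 : ℝ) ^ (-(n : ℝ)⁻¹) : ℝ) : ℂ) * Φ ((r : ℂ) * z)) 0 /
              k.factorial) =
          PowerSeries.mk fun k ↦ iteratedDeriv k g 0 / k.factorial := by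
  have hx : PowerSeries.HasSubst x := PowerSeries.HasSubst.of_constantCoeff_zero' hx0
  obtain ⟨H, hH⟩ := exists_int_qExpansion_twistedGen hn hconj F hint
  obtain ⟨f, hf⟩ := exists_subst_formalRoot_eq hx0 hx1 (PowerSeries.map (Int.castRingHom ℚ) H)
  have hfH' : PowerSeries.map (algebraMap ℚ ℂ) (f.subst x) = qExpansion ((2 * n : ℕ) : ℝ)
      (fun τ : ℍ ↦ (modularLambda τ / 16) ^ (2 * m) * (F τ / ModularForm.discriminant τ ^ m)) := by
    rw [hf, map_map_int, hH]
  refine ⟨f, ⟨H, hf.symm⟩, hfH', fun r hr0 hr1 ↦ ?_⟩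
  have hfH : (PowerSeries.map (algebraMap ℚ ℂ) f).subst (PowerSeries.map (algebraMap ℚ ℂ) x) =
      PowerSeries.mk fun k ↦ iteratedDeriv k (cuspFunction ((2 * n : ℕ) : ℝ)
        (fun τ : ℍ ↦ (modularLambda τ / 16) ^ (2 * m) *
          (F τ / ModularForm.discriminant τ ^ m))) 0 / k.factorial := by
    rw [taylor_cuspFunction_eq_qExpansion, ← hfH', map_subst' hx]
  exact exists_taylor_subst_eq_modFun hn hΦ hΦU hcov hΦ0 hconj F hL hx0 hx1 hxN hfH hr0 hr1

/-! ### §2. Transfer of `M_2`-linear independence to the formal expansions -/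

/-- The holomorphic function `λ/16` as an element of `𝓗`, lying in `M_2` (`λ ∈ M_2`).
[cite: CalegariDimitrovTang2025, §4.2 (`M_2 = ℚ(λ)`)] -/
theorem exists_modularLambda_div_sixteen_mem_levelField_two :
    ∃ Λ : hol, (Λ : ℍ → ℂ) = (fun τ : ℍ ↦ modularLambda τ / 16) ∧
      algebraMap hol Mer Λ ∈ levelField 2 := by
  obtain ⟨L, hL, hmem⟩ := exists_modularLambda_mem_levelField_two
  refine ⟨(16 : ℂ)⁻¹ • L, ?_, ?_⟩
  · funext τ
    rw [Subalgebra.coe_smul, Pi.smul_apply, hL, smul_eq_mul, div_eq_inv_mul]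
  · rw [Algebra.smul_def, map_mul, ← IsScalarTower.algebraMap_apply]
    exact mul_mem (IntermediateField.algebraMap_mem _ _) hmem

/-- Pointwise evaluation of a polynomial in an element of `𝓗`. [folklore] -/
private theorem coe_aeval_hol (Λ : hol) (P : Polynomial ℂ) (τ : ℍ) :
    ((Polynomial.aeval Λ P : hol) : ℍ → ℂ) τ = P.eval ((Λ : ℍ → ℂ) τ) := by
  change ((Pi.evalAlgHom ℂ (fun _ : ℍ ↦ ℂ) τ).comp hol.val) (Polynomial.aeval Λ P) = _
  rw [← Polynomial.aeval_algHom_apply, Polynomial.coe_aeval_eq_eval]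
  rfl

/-- A complex polynomial vanishing at `λ(τ)/16` for every `τ ∈ ℍ` is zero (`λ` takes every value
`≠ 0, 1`, infinitely many). [folklore] -/
private theorem eq_zero_of_forall_eval_modularLambda_div_sixteen {P : Polynomial ℂ}
    (h : ∀ τ : ℍ, P.eval (modularLambda τ / 16) = 0) : P = 0 := by
  classical
  by_contra hP
  obtain ⟨w, hw⟩ := Infinite.exists_notMem_finset (P.roots.toFinset ∪ {0, (16 : ℂ)⁻¹})
  simp only [Finset.mem_union, Multiset.mem_toFinset, Finset.mem_insert, Finset.mem_singleton,
    not_or] at hw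
  obtain ⟨hroot, hw0, hw16⟩ := hw
  have h0 : 16 * w ≠ 0 := mul_ne_zero (by norm_num) hw0
  have h1 : 16 * w ≠ 1 := fun h1 ↦ hw16 (inv_eq_of_mul_eq_one_right h1).symm
  obtain ⟨τ, hτ, hlam⟩ := exists_modularLambda_eq h0 h1
  have := h ⟨τ, hτ⟩
  rw [show (((⟨τ, hτ⟩ : ℍ) : ℂ)) = τ from rfl, hlam,
    mul_div_cancel_left₀ _ (by norm_num : (16 : ℂ) ≠ 0)] at this
  exact hroot ((Polynomial.mem_roots hP).mpr this)

/-- ★ **Transfer of linear independence** [cite: CalegariDimitrovTang2025, Proposition 3.0.1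
(proof: "the `ℚ(λ)`-linear dimension of the holonomic `ℚ(λ)`-module generated by all these
functions")]. Let `Fᵢ ∈ M_{12mᵢ}(Gᵢ)` (`Gᵢ` of finite index containing every conjugate of `T^{2n}`)
give generators `uᵢ = Fᵢ/Δ^{mᵢ}` of `R_{2n}` which are linearly independent over `M_2 = ℂ(λ)`, and
let `fᵢ ∈ ℚ⟦X⟧` be formal expansions of the twisted generators: `fᵢ(x(t)) = qExpansion (2n) hᵢ`,
`hᵢ = (λ/16)^{2mᵢ} uᵢ`, where `xⁿ = L(tⁿ)` and `qExpansion 2 (λ/16) = L`. Then a relation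
`Σᵢ Qᵢ(Xⁿ) fᵢ = 0` with `Qᵢ ∈ ℚ[X]` forces all `Qᵢ = 0`: substituting `X = x(t)` and comparing
`q`-expansions gives `Σᵢ Qᵢ(λ/16)(λ/16)^{2mᵢ} uᵢ = 0` with coefficients in `M_2`, and `λ` is
transcendental over `ℂ`. -/
theorem eq_zero_of_sum_aeval_mul_formalExpansion_eq_zero {n : ℕ} (hn : 0 < n)
    {L : PowerSeries ℤ}
    (hL : qExpansion 2 (fun τ : ℍ ↦ modularLambda τ / 16) = L.map (Int.castRingHom ℂ))
    {x : PowerSeries ℚ} (hx0 : PowerSeries.constantCoeff x = 0)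
    (hxN : x ^ n = PowerSeries.expand n hn.ne' (L.map (Int.castRingHom ℚ)))
    {ι : Type} [Fintype ι] (G : ι → Subgroup SL(2, ℤ)) (hG : ∀ i, (G i).FiniteIndex) (m : ι → ℕ)
    (hconj : ∀ i (g : SL(2, ℤ)), g * T ^ (2 * n) * g⁻¹ ∈ G i)
    (F : ∀ i, ModularForm ((G i : Subgroup SL(2, ℤ)) : Subgroup (GL (Fin 2) ℝ)) (12 * (m i : ℤ)))
    (hli : LinearIndependent (levelField 2) fun i ↦ algebraMap hol Mer (modFun (m i) (F i)))
    (f : ι → PowerSeries ℚ)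
    (hf : ∀ i, PowerSeries.map (algebraMap ℚ ℂ) ((f i).subst x) = qExpansion ((2 * n : ℕ) : ℝ)
      (fun τ : ℍ ↦ (modularLambda τ / 16) ^ (2 * m i) *
        (F i τ / ModularForm.discriminant τ ^ m i)))
    (Q : ι → Polynomial ℚ)
    (hQ : ∑ i, Polynomial.aeval ((PowerSeries.X : PowerSeries ℚ) ^ n) (Q i) * f i = 0) :
    ∀ i, Q i = 0 := by
  classical
  have h2n : (0 : ℝ) < ((2 * n : ℕ) : ℝ) := by exact_mod_cast (by omega : 0 < 2 * n)
  -- the functions `hᵢ`, the polynomials over `ℂ`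
  set h : ι → ℍ → ℂ := fun i τ ↦ (modularLambda τ / 16) ^ (2 * m i) *
    (F i τ / ModularForm.discriminant τ ^ m i) with hh
  set QC : ι → Polynomial ℂ := fun i ↦ (Q i).map (algebraMap ℚ ℂ) with hQC
  -- Step 1: substitute `X = x(t)`: `Σ Qᵢ(xⁿ) · fᵢ(x) = 0` in `ℚ⟦t⟧`
  have hx : PowerSeries.HasSubst x := PowerSeries.HasSubst.of_constantCoeff_zero' hx0
  have step1 : ∑ i, Polynomial.aeval (x ^ n) (Q i) * (f i).subst x = 0 := by
    have h1 := congrArg (PowerSeries.substAlgHom hx) hQ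
    rw [map_sum, map_zero] at h1
    rw [← h1]
    refine Finset.sum_congr rfl fun i _ ↦ ?_
    rw [map_mul, ← Polynomial.aeval_algHom_apply, map_pow, PowerSeries.substAlgHom_X,
      PowerSeries.coe_substAlgHom]
  -- Step 2: map to `ℂ⟦t⟧`: `Σ QCᵢ(qExp (λ/16)) · qExp hᵢ = 0`
  have hcompat : (algebraMap ℂ (PowerSeries ℂ)).comp (algebraMap ℚ ℂ) =
      (PowerSeries.map (algebraMap ℚ ℂ)).comp (algebraMap ℚ (PowerSeries ℚ)) := by
    ext q
    simp
  have hxC : PowerSeries.map (algebraMap ℚ ℂ) (x ^ n) = qExpansion ((2 * n : ℕ) : ℝ)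
      (fun τ : ℍ ↦ modularLambda τ / 16) := by
    rw [hxN, PowerSeries.map_expand, map_map_int, qExpansion_modularLambda_div_sixteen_eq_expand hn.ne' hL]
  have step2 : ∑ i, Polynomial.aeval (qExpansion ((2 * n : ℕ) : ℝ)
      (fun τ : ℍ ↦ modularLambda τ / 16)) (QC i) * qExpansion ((2 * n : ℕ) : ℝ) (h i) = 0 := by
    have h1 := congrArg (PowerSeries.map (algebraMap ℚ ℂ)) step1
    rw [map_sum, map_zero] at h1
    rw [← h1]
    refine Finset.sum_congr rfl fun i _ ↦ ?_
    rw [map_mul, Polynomial.map_aeval_eq_aeval_map hcompat, hxC, hf i]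
  -- Step 3: the function `g = Σ QCᵢ(λ/16) · hᵢ` is nice with zero `q`-expansion, hence zero
  have nlam := nice_modularLambda_div_sixteen_width n
  have nQ : ∀ i, Periodic ((fun τ : ℍ ↦ (QC i).eval (modularLambda τ / 16)) ∘ ofComplex)
      ((2 * n : ℕ) : ℝ) ∧ MDiff (fun τ : ℍ ↦ (QC i).eval (modularLambda τ / 16)) ∧
      IsBoundedAtImInfty (fun τ : ℍ ↦ (QC i).eval (modularLambda τ / 16)) := fun i ↦
    nice_polynomial_eval (QC i) nlam
  have nh : ∀ i, Periodic (h i ∘ ofComplex) ((2 * n : ℕ) : ℝ) ∧ MDiff (h i) ∧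
      IsBoundedAtImInfty (h i) := fun i ↦ by
    haveI := hG i
    exact nice_twistedGen (hconj i) (F i)
  set g : ℍ → ℂ := ∑ i, (fun τ : ℍ ↦ (QC i).eval (modularLambda τ / 16)) * h i with hg
  have ng_term : ∀ i ∈ (Finset.univ : Finset ι),
      Periodic (((fun τ : ℍ ↦ (QC i).eval (modularLambda τ / 16)) * h i) ∘ ofComplex)
        ((2 * n : ℕ) : ℝ) ∧ MDiff ((fun τ : ℍ ↦ (QC i).eval (modularLambda τ / 16)) * h i) ∧
      IsBoundedAtImInfty ((fun τ : ℍ ↦ (QC i).eval (modularLambda τ / 16)) * h i) :=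
    fun i _ ↦ nice_mul (nQ i) (nh i)
  have ng := nice_sum Finset.univ ng_term
  have hgexp : qExpansion ((2 * n : ℕ) : ℝ) g = 0 := by
    rw [hg, qExpansion_sum_of_nice _ h2n ng_term, ← step2]
    refine Finset.sum_congr rfl fun i _ ↦ ?_
    rw [qExpansion_mul_of_nice h2n (nQ i) (nh i), qExpansion_polynomial_eval h2n (QC i) nlam]
  have hg0 : g = 0 :=
    eq_of_qExpansion_eq h2n ng (nice_zero _) (by rw [hgexp, qExpansion_zero])
  -- Step 4: the relation in `Mer` with coefficients in `M_2`
  obtain ⟨Λ, hΛ, hΛmem⟩ := exists_modularLambda_div_sixteen_mem_levelField_two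
  set K : IntermediateField ℂ Mer := levelField 2 with hK
  obtain ⟨lam, hlam⟩ : ∃ lam : K, (lam : Mer) = algebraMap hol Mer Λ := ⟨⟨_, hΛmem⟩, rfl⟩
  let c : ι → K := fun i ↦ Polynomial.aeval lam (QC i) * lam ^ (2 * m i)
  have hcval : ∀ i, ((c i : K) : Mer) =
      algebraMap hol Mer (Polynomial.aeval Λ (QC i) * Λ ^ (2 * m i)) := by
    intro i
    rw [map_mul, map_pow, ← Polynomial.aeval_algebraMap_apply, ← hlam]
    change K.val (Polynomial.aeval lam (QC i) * lam ^ (2 * m i)) = _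
    rw [map_mul, map_pow, ← Polynomial.aeval_algHom_apply]
    rfl
  have hrel : ∑ i, c i • algebraMap hol Mer (modFun (m i) (F i)) = 0 := by
    have hterm : ∀ i, c i • algebraMap hol Mer (modFun (m i) (F i)) =
        algebraMap hol Mer (Polynomial.aeval Λ (QC i) * Λ ^ (2 * m i) * modFun (m i) (F i)) := by
      intro i
      rw [IntermediateField.smul_def, smul_eq_mul, hcval, ← map_mul]
    simp_rw [hterm]
    rw [← map_sum]
    have hzero : (∑ i, Polynomial.aeval Λ (QC i) * Λ ^ (2 * m i) * modFun (m i) (F i) : hol) = 0 := by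
      apply Subtype.ext
      funext τ
      have hgτ := congrFun hg0 τ
      rw [hg, Finset.sum_apply, Pi.zero_apply] at hgτ
      rw [show ((∑ i, Polynomial.aeval Λ (QC i) * Λ ^ (2 * m i) * modFun (m i) (F i) : hol) :
          ℍ → ℂ) τ = ∑ i, ((Polynomial.aeval Λ (QC i) * Λ ^ (2 * m i) * modFun (m i) (F i) : hol) :
          ℍ → ℂ) τ by
        rw [← Finset.sum_apply]
        exact congrFun (map_sum hol.val _ _) τ]
      rw [Subalgebra.coe_zero, Pi.zero_apply, ← hgτ]
      refine Finset.sum_congr rfl fun i _ ↦ ?_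
      rw [Subalgebra.coe_mul, Subalgebra.coe_mul, Subalgebra.coe_pow, Pi.mul_apply, Pi.mul_apply,
        Pi.pow_apply, coe_aeval_hol, hΛ, modFun_apply, Pi.mul_apply, hh]
      ring
    rw [hzero, map_zero]
  -- Step 5: linear independence ⟹ `cᵢ = 0` ⟹ `QCᵢ(λ/16) = 0` ⟹ `Qᵢ = 0`
  intro i
  have hci : c i = 0 := Fintype.linearIndependent_iff.mp hli c hrel i
  have hci' : Polynomial.aeval Λ (QC i) * Λ ^ (2 * m i) = 0 := by
    apply algebraMap_hol_injective
    rw [← hcval, hci, map_zero]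
    rfl
  have hΛ0 : Λ ≠ 0 := by
    intro h0
    have := congrArg (fun f : hol ↦ (f : ℍ → ℂ) UpperHalfPlane.I) h0
    simp only [hΛ, Subalgebra.coe_zero, Pi.zero_apply, div_eq_zero_iff] at this
    rcases this with h | h
    · exact modularLambda_ne_zero UpperHalfPlane.I.im_pos h
    · norm_num at h
  have haev : Polynomial.aeval Λ (QC i) = 0 :=
    (mul_eq_zero.mp hci').resolve_right (pow_ne_zero _ hΛ0)
  have hQC : QC i = 0 := by
    refine eq_zero_of_forall_eval_modularLambda_div_sixteen fun τ ↦ ?_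
    have := congrArg (fun f : hol ↦ (f : ℍ → ℂ) τ) haev
    simpa only [coe_aeval_hol, hΛ, Subalgebra.coe_zero, Pi.zero_apply] using this
  have hQ0 : (Q i).map (algebraMap ℚ ℂ) = 0 := hQC
  exact (Polynomial.map_eq_zero_iff (algebraMap ℚ ℂ).injective).mp hQ0

/-! ### §3. Proposition 3.0.1: at most `C N³ log N` independent generators -/

/-- **CDT Proposition 3.0.1, threshold form.** There are `n₀ ≥ 1` and `C ≥ 0` such that for every
`n ≥ n₀`, every finite set of generators of `R_{2n}` (`bddDenGens (2n)`) which is linearly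
independent over `M_2 = levelField 2` has at most `C n³ log n` elements: enumerate the set, attach
to each generator `F/Δᵐ` the formal expansion of `(λ/16)^{2m} F/Δᵐ`
(`exists_formalExpansion_twistedGen`: integral, admissible along the universal covering
`Φ : 𝔻 → ℂ ∖ μ_n`), transfer the independence (`eq_zero_of_sum_aeval_mul_formalExpansion_eq_zero`),
and apply the holonomy bound `dim_le_unconditional` (Theorem 2.0.1 with the radius bound
Theorem 5.1.4; the threshold `n₀` only serves its side condition `A/n³ ≤ 2/9`).
[cite: CalegariDimitrovTang2025, Proposition 3.0.1] -/
theorem linearIndepOn_bddDenGens_card_le_of_le :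
    ∃ (n₀ : ℕ) (C : ℝ), 0 < n₀ ∧ 0 ≤ C ∧ ∀ n : ℕ, n₀ ≤ n → ∀ s : Finset Mer,
      (s : Set Mer) ⊆ bddDenGens (2 * n) → LinearIndepOn (levelField 2) id (s : Set Mer) →
      (s.card : ℝ) ≤ C * (n : ℝ) ^ 3 * Real.log n := by
  classical
  obtain ⟨A, C, hA, hdim⟩ :=
    Literature.Analysis.Complex.CalegariDimitrovTang2025_unboundedDenominators.dim_le_unconditional
  refine ⟨max 2 ⌈9 * A / 2⌉₊, max C 0, lt_of_lt_of_le two_pos (le_max_left _ _), le_max_right _ _,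
    ?_⟩
  intro n hn s hs hli
  have h2n : 2 ≤ n := le_trans (le_max_left _ _) hn
  have hn0 : 0 < n := by omega
  have hnA : (⌈9 * A / 2⌉₊ : ℝ) ≤ n := by exact_mod_cast le_trans (le_max_right _ _) hn
  have hnA' : 9 * A / 2 ≤ n := (Nat.le_ceil _).trans hnA
  have hn1 : (1 : ℝ) ≤ n := by exact_mod_cast hn0
  have hn3 : (n : ℝ) ≤ (n : ℝ) ^ 3 := le_self_pow₀ hn1 three_ne_zero
  have hAn : A / (n : ℝ) ^ 3 ≤ 2 / 9 := by
    rw [div_le_div_iff₀ (by positivity) (by norm_num)]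
    nlinarith
  -- the universal covering of `ℂ ∖ μ_n` and the formal root `x`
  obtain ⟨Φ, hΦU, hΦ, -, hcov, hΦ0⟩ := exists_isCoveringMap_compl_rootsOfUnity h2n
  obtain ⟨L, x, hL, -, hx0, hx1, hxN⟩ := exists_formal_root_qExpansion_modularLambda hn0.ne'
  -- enumerate `s` and unpack the generators
  set M : ℕ := s.card with hM
  let e : Fin M ≃ s := s.equivFin.symm
  have hu : ∀ i : Fin M, ∃ (G : Subgroup SL(2, ℤ)) (_ : G.FiniteIndex) (m : ℕ)
      (F : ModularForm (G : Subgroup (GL (Fin 2) ℝ)) (12 * (m : ℤ))),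
      (∀ g : SL(2, ℤ), g * T ^ (2 * n) * g⁻¹ ∈ G) ∧
      (∀ k : ℕ, ∃ z : ℤ, PowerSeries.coeff k (qExpansion ((2 * n : ℕ) : ℝ) F) = (z : ℂ)) ∧
      ((e i : s) : Mer) = algebraMap hol Mer (modFun m F) := fun i ↦ hs (e i).2
  choose G hGfi m F hconj hint hueq using hu
  -- the formal expansions of the twisted generators
  have hpack : ∀ i : Fin M, ∃ f : PowerSeries ℚ,
      (∃ H : PowerSeries ℤ, PowerSeries.map (Int.castRingHom ℚ) H = f.subst x) ∧
      (PowerSeries.map (algebraMap ℚ ℂ) (f.subst x) = qExpansion ((2 * n : ℕ) : ℝ)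
        (fun τ : ℍ ↦ (modularLambda τ / 16) ^ (2 * m i) *
          (F i τ / ModularForm.discriminant τ ^ m i))) ∧
      ∀ r : ℝ, 0 < r → r < 1 → ∃ g : ℂ → ℂ, AnalyticOnNhd ℂ g (closedBall 0 1) ∧
        (PowerSeries.map (algebraMap ℚ ℂ) f).subst (PowerSeries.mk fun k ↦
            iteratedDeriv k (fun z : ℂ ↦ (((16 : ℝ) ^ (-(n : ℝ)⁻¹) : ℝ) : ℂ) * Φ ((r : ℂ) * z)) 0 /
              k.factorial) =
          PowerSeries.mk fun k ↦ iteratedDeriv k g 0 / k.factorial := fun i ↦ by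
    haveI := hGfi i
    exact exists_formalExpansion_twistedGen hn0 hΦ hΦU hcov hΦ0 hL hx0 hx1 hxN (hconj i) (F i)
      (hint i)
  choose f hfint hfH hfan using hpack
  -- linear independence of the enumerated family over `M_2`
  have hli' : LinearIndependent (levelField 2)
      fun i : Fin M ↦ algebraMap hol Mer (modFun (m i) (F i)) := by
    have h1 : LinearIndependent (levelField 2) (fun j : s ↦ (j : Mer)) := hli
    have h2 := h1.comp e e.injective
    convert h2 using 1
    funext i
    rw [Function.comp_apply]
    exact (hueq i).symm
  have hind := eq_zero_of_sum_aeval_mul_formalExpansion_eq_zero hn0 hL hx0 hxN G hGfi m hconj F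
    hli' f hfH
  -- the radius `r = 1 - A/(2n³) ∈ (0, 1)`
  have hr0 : 0 < 1 - A / (2 * (n : ℝ) ^ 3) := by
    have : A / (2 * (n : ℝ) ^ 3) = (A / (n : ℝ) ^ 3) / 2 := by ring
    rw [this]; linarith
  have hr1 : 1 - A / (2 * (n : ℝ) ^ 3) < 1 := by
    have : 0 < A / (2 * (n : ℝ) ^ 3) := by positivity
    linarith
  -- the holonomy bound
  have hbound := hdim n h2n hAn Φ hΦU hΦ hcov hΦ0 _ rfl M x hx0 hx1
    ⟨PowerSeries.expand n hn0.ne' L, by rw [PowerSeries.map_expand, hxN]⟩ f hind hfint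
    (fun i ↦ hfan i _ hr0 hr1)
  have hlog : 0 ≤ Real.log n := Real.log_nonneg hn1
  calc (M : ℝ) ≤ C * (n : ℝ) ^ 3 * Real.log n := hbound
    _ ≤ max C 0 * (n : ℝ) ^ 3 * Real.log n :=
        mul_le_mul_of_nonneg_right (mul_le_mul_of_nonneg_right (le_max_left _ _) (by positivity))
          hlog

/-- ★★ **CDT Proposition 3.0.1 in the shape consumed by §6.3** ("the `ℚ(λ)`-linear dimension of
the holonomic `ℚ(λ)`-module generated by all these functions is at most `C N³ log N`"): there is a
constant `C` such that for every even `N > 0`, every finite set of generators of `R_N` which is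
linearly independent over `M_2` has at most `C N³ log N` elements. (Small levels are absorbed by
`R_N ⊆ R_{N n₀}`, `bddDenGens_mono`.) This is exactly the hypothesis `hhol` of
`CalegariDimitrovTang2025_unboundedDenominators.of_printed_inputs''`.
[cite: CalegariDimitrovTang2025, Proposition 3.0.1] -/
theorem linearIndepOn_bddDenGens_card_le :
    ∃ C : ℝ, ∀ N : ℕ, 0 < N → Even N → ∀ s : Finset Mer, (s : Set Mer) ⊆ bddDenGens N →
      LinearIndepOn (levelField 2) id (s : Set Mer) →
      (s.card : ℝ) ≤ C * (N : ℝ) ^ 3 * Real.log N := by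
  obtain ⟨n₀, C, hn₀, hC, hcore⟩ := linearIndepOn_bddDenGens_card_le_of_le
  refine ⟨C * (n₀ : ℝ) ^ 3 * (1 + Real.log n₀ / Real.log 2), ?_⟩
  intro N hN heven s hs hli
  obtain ⟨k, hk⟩ := heven
  have hk0 : 0 < k := by omega
  have hNk : N = 2 * k := by omega
  -- go up to the level `2 (k n₀)`
  have hsub : (s : Set Mer) ⊆ bddDenGens (2 * (k * n₀)) :=
    hs.trans (bddDenGens_mono hN ⟨n₀, by rw [hNk]; ring⟩
      (Nat.mul_ne_zero two_ne_zero (Nat.mul_ne_zero hk0.ne' hn₀.ne')))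
  have h := hcore (k * n₀) (by nlinarith) s hsub hli
  -- bookkeeping: `(k n₀)³ log (k n₀) ≤ n₀³ (1 + log n₀ / log 2) · N³ log N`
  have hN2 : (2 : ℝ) ≤ N := by exact_mod_cast (show 2 ≤ N by omega)
  have hkN : (k : ℝ) ≤ N := by exact_mod_cast (show k ≤ N by omega)
  have hk1 : (1 : ℝ) ≤ k := by exact_mod_cast hk0
  have hn₀1 : (1 : ℝ) ≤ n₀ := by exact_mod_cast hn₀
  have hlog2 : 0 < Real.log 2 := Real.log_pos one_lt_two
  have hlogN : Real.log 2 ≤ Real.log N := Real.log_le_log two_pos hN2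
  have hlogk : Real.log k ≤ Real.log N := Real.log_le_log (by positivity) hkN
  have hlogk0 : 0 ≤ Real.log k := Real.log_nonneg hk1
  have hlogn₀ : 0 ≤ Real.log n₀ := Real.log_nonneg hn₀1
  have hprod : Real.log ((k * n₀ : ℕ) : ℝ) = Real.log k + Real.log n₀ := by
    push_cast
    exact Real.log_mul (by positivity) (by positivity)
  have hinner : (k : ℝ) ^ 3 * (Real.log k + Real.log n₀) ≤
      (N : ℝ) ^ 3 * (Real.log N + Real.log n₀ / Real.log 2 * Real.log N) := by
    apply mul_le_mul (pow_le_pow_left₀ (by positivity) hkN 3) ?_ (add_nonneg hlogk0 hlogn₀)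
      (by positivity)
    have h3 : Real.log n₀ ≤ Real.log n₀ / Real.log 2 * Real.log N := by
      calc Real.log n₀ = Real.log n₀ / Real.log 2 * Real.log 2 := by field_simp
        _ ≤ Real.log n₀ / Real.log 2 * Real.log N :=
            mul_le_mul_of_nonneg_left hlogN (div_nonneg hlogn₀ hlog2.le)
    linarith
  calc (s.card : ℝ) ≤ C * ((k * n₀ : ℕ) : ℝ) ^ 3 * Real.log ((k * n₀ : ℕ) : ℝ) := h
    _ = C * (n₀ : ℝ) ^ 3 * ((k : ℝ) ^ 3 * (Real.log k + Real.log n₀)) := by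
        rw [hprod]; push_cast; ring
    _ ≤ C * (n₀ : ℝ) ^ 3 * ((N : ℝ) ^ 3 * (Real.log N + Real.log n₀ / Real.log 2 * Real.log N)) :=
        mul_le_mul_of_nonneg_left hinner (mul_nonneg hC (by positivity))
    _ = C * (n₀ : ℝ) ^ 3 * (1 + Real.log n₀ / Real.log 2) * (N : ℝ) ^ 3 * Real.log N := by ring

/-! ### §4. Theorem 1.0.1 from four printed inputs -/

/-- ★★★ **CDT Theorem 1.0.1 from FOUR printed inputs** [cite: CalegariDimitrovTang2025, §6.3 and
Proposition 3.0.1]: the named fact `CalegariDimitrovTang2025_unboundedDenominators` follows from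
`hker₂` (amalgam + congruence subgroup property for `SL₂(ℤ[1/p])`, Serre/Mennicke), `hcor`
(CDT Corollary 4.5.3), Shimura's Theorem 3.52 (integral spanning of `M_{12m}(Γ(N))`) and the degree
formula (4.3.3) `c N³ ≤ [M_N : M_2]`. Proposition 3.0.1 (`hhol` of `…of_printed_inputs''`) is now
PROVED (`linearIndepOn_bddDenGens_card_le`): the holonomy bound Theorem 2.0.1, the radius bound
Theorem 5.1.4, the algebraization along the universal covering of `ℂ ∖ μ_N` and the formal side
above are all theorems of the tree. -/
theorem _root_.Literature.NumberTheory.Automorphic.CalegariDimitrovTang2025_unboundedDenominators.of_printed_inputs'''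
    (hker₂ : ∀ (N p : ℕ) (A : GL (Fin 2) ℝ), 0 < N →
      (A : Matrix (Fin 2) (Fin 2) ℝ) = !![(p : ℝ), 0; 0, 1] → p.Prime → ¬ p ∣ N →
      ∀ (Δ : Type) [Group Δ] [Finite Δ] (g₁ g₂ : Gamma N →* Δ),
      (∀ (x : SL(2, ℤ)) (hx : x ∈ Gamma N), x ∈ Gamma0 p → ∀ (y : SL(2, ℤ)) (hy : y ∈ Gamma N),
        A * mapGL ℝ x = mapGL ℝ y * A → g₁ ⟨x, hx⟩ = g₂ ⟨y, hy⟩) →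
      (∃ M : ℕ, M ≠ 0 ∧ ∀ (x : SL(2, ℤ)) (hx : x ∈ Gamma N), x ∈ Gamma M → g₁ ⟨x, hx⟩ = 1) ∧
      (∃ M : ℕ, M ≠ 0 ∧ ∀ (x : SL(2, ℤ)) (hx : x ∈ Gamma N), x ∈ Gamma M → g₂ ⟨x, hx⟩ = 1))
    (hcor : ∀ (N : ℕ) (Q : Type) [CommGroup Q] [Finite Q] (θ : Gamma N →* Q),
      (∀ g : SL(2, ℤ), ∃ M : ℕ, M ≠ 0 ∧ ∀ (x : SL(2, ℤ)) (hx : x ∈ Gamma N)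
        (hgx : g * x * g⁻¹ ∈ Gamma N), x ∈ Gamma M → θ ⟨g * x * g⁻¹, hgx⟩ = θ ⟨x, hx⟩) →
      ∃ M : ℕ, M ≠ 0 ∧ ∀ (x : SL(2, ℤ)) (hx : x ∈ Gamma N), x ∈ Gamma M → θ ⟨x, hx⟩ = 1)
    (hShimura : ∀ (N : ℕ), 0 < N → ∀ (m : ℕ)
      (F : ModularForm ((Gamma N : Subgroup SL(2, ℤ)) : Subgroup (GL (Fin 2) ℝ)) (12 * (m : ℤ))),
      ∃ (ι : Type) (_ : Fintype ι) (c : ι → ℂ)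
      (B : ι → ModularForm ((Gamma N : Subgroup SL(2, ℤ)) : Subgroup (GL (Fin 2) ℝ)) (12 * (m : ℤ))),
      (∀ i (n : ℕ), ∃ z : ℤ, PowerSeries.coeff n (qExpansion (N : ℝ) (B i)) = (z : ℂ)) ∧
      (F : ℍ → ℂ) = ∑ i, c i • (B i : ℍ → ℂ))
    (hdeg : ∃ c : ℝ, 0 < c ∧ ∀ N : ℕ, 0 < N → Even N →
      c * (N : ℝ) ^ 3 ≤ IntermediateField.relfinrank (levelField 2) (levelField N)) :
    CalegariDimitrovTang2025_unboundedDenominators :=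
  CalegariDimitrovTang2025_unboundedDenominators.of_printed_inputs'' hker₂ hcor hShimura hdeg
    linearIndepOn_bddDenGens_card_le

end UnboundedDenominators

end Literature.NumberTheory.Automorphic

end
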